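import Summits.CriticalPhenomena.PercolationContinuityZ3.Theses.PercNonProliferation

/-!
# Triage probe (r2, triager 2) — crux `NonProliferation` (stmt-CriticalPhenomena-4444)

Typed shapes used in TRIAGE-r2-2.md:
* the crux probe;
* card `avoidance-cost-covering`: `multiCross`, `CoveringDecay`, `AvoidanceCostRatio` (verbatim from the card) and
  `crux_iff` (the ratio-2 event IS the complement of the crux event);
* the SHELL count `shellCross` and the quantile-bootstrap statements `coveringDecay_of_shellTightQuarter`,
  `shellTight_of_coveringDecay` (paper proofs in TRIAGE §A; sorried here — typed targets, not claims):
  `CoveringDecay ↔ uniform tightness of the ratio-2 shell count`, i.e. the card's C⁺ is the '1-ε tightness'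
  strengthening of the crux in shell form;
* `avoidanceCostRatio_of_uniformAnnulusDecay`: in a θ(p_c)=0 world the card's residual follows from uniform annulus
  decay ALONE by domain monotonicity + BK (blocking ⇒ summit; the card's own warning §D applies to its residual).
-/

noncomputable section

namespace Summit.CriticalPhenomena.PercolationContinuityZ3.Cruxes.NonProliferation.TriageR2K2

open MeasureTheory Filter Topology
open Literature.Probability.LatticeModels Literature.Probability.Percolation
open Summit.CriticalPhenomena.PercolationContinuityZ3.Theses.PercNonProliferation

theorem probe : NonProliferation := by
  sorry

abbrev μ : Measure (BondConfig (Site 3)) := bondPercolation (zdGraph 3) (criticalProbI 3)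

/-- `N(m,km) ≥ M+1` (card avoidance-cost-covering, verbatim). -/
def multiCross (M k m : ℕ) : Set (BondConfig (Site 3)) :=
  {ω | ∃ x : Fin (M + 1) → Site 3, (∀ i, x i ∈ box 3 m) ∧
    (∀ i, ∃ y ∈ innerBoundary (zdGraph 3) (box 3 (k * m)), ω ∈ openConnIn ↑(box 3 (k * m)) (x i) y) ∧
    ∀ i j, i ≠ j → ω ∉ openConnIn ↑(box 3 (k * m)) (x i) (x j)}

/-- The crux is `∃ M c>0, ∃ᶠ n, c ≤ P((multiCross M 2 n)ᶜ)` — definitionally. -/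
theorem crux_iff : NonProliferation ↔ ∃ (M : ℕ) (c : ℝ), 0 < c ∧ ∃ᶠ n : ℕ in atTop, c ≤ μ.real (multiCross M 2 n)ᶜ :=
  Iff.rfl

/-- Card C⁺ (verbatim). -/
def CoveringDecay : Prop :=
  ∃ (M : ℕ) (C δ : ℝ), 0 < δ ∧ ∀ k m : ℕ, 2 ≤ k → 1 ≤ m →
    μ.real (multiCross M k m) ≤ C * (k : ℝ) ^ (-(2 + δ))

/-- Card residual (verbatim). -/
def AvoidanceCostRatio : Prop :=
  ∃ (ζ C : ℝ), 0 < ζ ∧ ∀ k m j : ℕ, 2 ≤ k → 1 ≤ m →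
    μ.real (multiCross (j + 1) k m) ≤ C * (k : ℝ) ^ (-ζ) * μ.real (multiCross j k m)

/-- SHELL count `N_sh(m,L) ≥ M+1`: `M+1` points of the sphere `{|v|∞ = m}` (= innerBoundary of `B(m)`), each joined to
`∂⁻B(L)` inside the CLOSED SHELL `B(L) \ B(m-1)… = {m ≤ |v| ≤ L}`, pairwise not joined inside the shell.
`N(m,L) ≤ N_sh(m,L)` pointwise (last-visit segments; shell-joined ⇒ box-joined). -/
def shellCross (M m L : ℕ) : Set (BondConfig (Site 3)) :=
  {ω | ∃ x : Fin (M + 1) → Site 3, (∀ i, x i ∈ innerBoundary (zdGraph 3) (box 3 m)) ∧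
    (∀ i, ∃ y ∈ innerBoundary (zdGraph 3) (box 3 L),
      ω ∈ openConnIn (↑(box 3 L) \ ↑(box 3 (m - 1))) (x i) y) ∧
    ∀ i j, i ≠ j → ω ∉ openConnIn (↑(box 3 L) \ ↑(box 3 (m - 1))) (x i) (x j)}

/-- Uniform quantile-3/4 tightness of the ratio-2 SHELL count (the '1-ε tightness' form of the crux, shell variant,
at the union-bound threshold 1/4 of MEMO-ideator6 §2). -/
def ShellTightQuarter : Prop :=
  ∃ (M : ℕ) (q : ℝ), q < 1 / 4 ∧ ∀ m : ℕ, 1 ≤ m → μ.real (shellCross M m (2 * m)) ≤ q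

/-- Bootstrap ⇒ (paper proof, TRIAGE §A.2): ratio-2 shells `{a_i ≤ |v| ≤ 2a_i}`, `a_i = 2^i(m+1)-1`, are vertex-disjoint,
`⌊log₂ k⌋-1` of them fit in `{m ≤ |v| ≤ km}`, each is crossed by `M+1` shell-distinct pieces of the `M+1` box-distinct
crossers (independence) ⇒ `P(multiCross M k m) ≤ P(shellCross M m (km)) ≤ q^{⌊log₂k⌋-1} ≤ q⁻² k^{-log₂(1/q)}`,
exponent `log₂(1/q) > 2`. -/
theorem coveringDecay_of_shellTightQuarter : ShellTightQuarter → CoveringDecay := by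
  sorry

/-- Bootstrap ⇐ (paper proof, TRIAGE §A.2): cover the mid-sphere `{|v| = 3n/2}` by `K(k) ≍ k²` translates `z+B(m)`,
`km < n/2`; every shell-crosser of `{n ≤ |v| ≤ 2n}` meets it and contains a crosser of `z+A(m,km) ⊂ shell`, distinct
ones stay distinct ⇒ `P(shellCross (K(k)M) n (2n)) ≤ K(k)·C k^{-(2+δ)} → 0` (k → ∞), uniformly in `n ≥ n₀(k)`. -/
theorem shellTight_of_coveringDecay :
    CoveringDecay → ∀ ε : ℝ, 0 < ε → ∃ M n₀ : ℕ, ∀ n : ℕ, n₀ ≤ n → μ.real (shellCross M n (2 * n)) ≤ ε := by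
  sorry

/-- Uniform annulus decay (an RSW/one-arm-type BLOCKING statement; `m = 1` gives `θ(p_c) = 0` outright). -/
def UniformAnnulusDecay : Prop :=
  ∃ (ζ C : ℝ), 0 < ζ ∧ ∀ k m : ℕ, 2 ≤ k → 1 ≤ m → μ.real (multiCross 0 k m) ≤ C * (k : ℝ) ^ (-ζ)

/-- In a continuous world the card's residual is blocking + monotonicity (paper proof: the exploration renewal
identity `P(N ≥ j+2) = E[φ(D_{j+1}); N ≥ j+1]` of card independent-copy-screening and domain monotonicity
`φ(D) ≤ φ(B(km)) = P(N ≥ 1)` — equivalently Reimer with cluster+closed-skin witnesses, tree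
`reimer_local_finitary_list` — give `P(N ≥ j+2) ≤ P(N ≥ 1)·P(N ≥ j+1)`; then insert `UniformAnnulusDecay`). -/
theorem avoidanceCostRatio_of_uniformAnnulusDecay : UniformAnnulusDecay → AvoidanceCostRatio := by
  sorry

end Summit.CriticalPhenomena.PercolationContinuityZ3.Cruxes.NonProliferation.TriageR2K2

end
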